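import Summits.BirchSwinnertonDyer.BirchSwinnertonDyer.Theses.PAdicOrderV2
import Summits.BirchSwinnertonDyer.BirchSwinnertonDyer.Theses.SelmerRank
import Summits.BirchSwinnertonDyer.BirchSwinnertonDyer.Theses.PAdicOrder
import Summits.BirchSwinnertonDyer.BirchSwinnertonDyer.Theorems.PAdicOrderV2PAdicOrderComparisonR2StubConstantCoeff
import Summits.BirchSwinnertonDyer.BirchSwinnertonDyer.Theorems.PAdicOrderV2PAdicOrderComparisonR2StubTwoLeOrder
import Summits.BirchSwinnertonDyer.BirchSwinnertonDyer.Theorems.PAdicOrderV2PAdicOrderComparisonR2OddOfItems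
import Summits.BirchSwinnertonDyer.BirchSwinnertonDyer.Theorems.PAdicOrderV2PAdicOrderComparisonR2OfItemsControlTwo
import Summits.BirchSwinnertonDyer.BirchSwinnertonDyer.Theorems.PAdicOrderV2PAdicOrderComparisonR2OfRouteItems
import Literature.NumberTheory.EllipticCurves.SelmerCorankControlRatOrdinaryProofs
import Literature.NumberTheory.EllipticCurves.KatoRankBound

/-!
# Line `Sketch` — skeleton v13 for crux #2 `PAdicOrderComparisonR2` (stmt-BirchSwinnertonDyer-0489)

Crux: for `E/ℚ` (globally minimal `W`), every good ordinary prime `p` and the newform `f` of `E`,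
`ord_{T=0} L_p(f, α_p, T) = ord_{s=1} L(E, s)` in `ℕ∞`
(`L_p = Literature.NumberTheory.EllipticCurves.padicLFunction f (unitRoot W p)`).

## Composition (v13, lead `prover-line-stmt-BirchSwinnertonDyer-0489-c4-0`, 2026-08-17)

v1–v12 split the equality of orders along the literature's fault lines and routed the rank-`≥ 2`
case through the Selmer corank (leads c0–c3; v12: crux ⇐ seven route items ∧ MC2 ∧ SS2, the
`p = 2` instances of items 15426 / 0509). v13 makes two changes and adds one composition.

(i) Item h5 (crux #5 `PAdicOrderRankOneR4`, rank one) is DROPPED: at an odd good ordinary `p` the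
chain `ord_T L_p = ord_T g = rank_{ℤ_p} X/TX = corank Sel_{p^∞}(E/ℚ) = r_an` (item
`PAdicOrderMainConjectureR7`; item `PAdicOrderSemisimpleR3` through the landed SS-bridge; Mazur
control, DISCHARGED in tree as `Greenberg1999_coinvariantsRank_eq_selmerCorank_rat_holds`; the
landed bookkeeping `stub_order_eq_selmerCorank`; the Selmer side from route SelmerRank's four items,
`selmerCorank_eq_analyticRank_of_selmerRankItems`) holds in EVERY analytic rank — the landed
`order_eq_analyticRank_of_mc_ss_control` (p135966) — so neither the rank-0 interpolation leg nor
crux #5 nor the parity / Kato lower-bound legs are needed at odd `p` (`order_eq_analyticRank_odd_of_items`).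
Crux #5 is therefore not on the critical path of crux #2.

(ii) The `p = 2` residue is ALIGNED with crux #3's line (`Cruxes/PAdicOrderPadicBSDrankR2/Lines/Sketch.lean`
v5.1, stmt-BirchSwinnertonDyer-0490): the v12 stubs MC2 ∧ SS2 (conjecture-instances beyond print)
are replaced by
* K2 `stub_katoAllPrimes` — Kato's Selmer-corank bound `corank Sel_{p^∞} ≤ ord_T L_p` at EVERY
  good ordinary prime, the ∀-closure of the vendored named fact
  `kato_selmerCorank_le_order_padicLFunction_allPrimes` (Kato, Astérisque 295, Thm 18.4 as printed,
  no parity hypothesis): LITERATURE DEBT, not conjecture; consumed only at `p = 2` in analytic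
  rank `≥ 3` (ranks 1, 2 get their lower bound from interpolation S1 / parity L2, both landed and
  parity-free); VERBATIM crux #3's registered stub `stub_padicBSDrank_kato`;
* NE2⁺ `stub_noExcessTwoPos` — no excess zeros at `p = 2` in positive rank,
  `ord_T L_2(E,T) ≤ corank_{ℤ_2} Sel_{2^∞}(E/ℚ)`: VERBATIM crux #3's registered stub
  `stub_padicBSDrank_noExcessTwoPos`; OPEN beyond print (at odd `p` it is IMC-equality ∧ Conj. 1.12
  ∧ control; MC2 ∧ SS2 ∧ CT ⇒ NE2⁺, so v13's open content is weaker than v12's).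
With the Selmer side (`corank Sel_2 = r_an`, `rank = r_an` from the SelmerRank items) these give
`ord_T L_2 = r_an` in every analytic rank (`order_eq_analyticRank_two_of_stubs`): rank 0 by S1;
rank `≥ 1`: `≤` by NE2⁺, `≥` by S1 (rank 1) / L2 (rank 2) / K2 (rank `≥ 3`).

(iii) The stub-FREE composition `pAdicOrderComparisonR2_of_padicBSDrank`: crux #2 ⇐ crux #3
`PAdicOrderPadicBSDrankR2` (stmt-0490, `ord_T L_p = rank E(ℚ)` at every good ordinary `p`) ∧
SelmerRank LB/UB/SI/Sha (`rank = r_an`, landed `mordellWeilRank_eq_analyticRank_of_selmerRankItems`),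
and its converse `padicBSDrank_of_pAdicOrderComparisonR2`: cruxes #2 and #3 are EQUIVALENT modulo
route SelmerRank's items, at every prime. So crux #2 is a glue node over existing items; content of
#2 independent of #3's inputs needs a different line (cards derived-kato-fine-regulator,
height-pencil-split, heegner-torsion-squeeze, unit-root-null-line — not yet lines).

`pAdicOrderComparisonR2_of_stubs` concludes the crux BY NAME from the six admissible item
hypotheses (hLB, hUB, hSI, hSha, hSS, hMC), the landed legs and the two registered stubs (K2, NE2⁺);
`pAdicOrderComparisonR2_of_stubs'` concludes the twin decl of route PAdicOrder.
Landed legs used: S1 `stub_constantCoeff_eq_zero_iff` (p97010), L2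
`stub_two_le_order_of_analyticRank_eq_two` (p99469), `order_eq_analyticRank_of_mc_ss_control`
(p135966), `selmerCorank_eq_analyticRank_of_selmerRankItems` /
`mordellWeilRank_eq_analyticRank_of_selmerRankItems` (p135381),
`Greenberg1999_coinvariantsRank_eq_selmerCorank_rat_holds` (p137277).
-/

set_option linter.dupNamespace false

namespace Summit.BirchSwinnertonDyer.BirchSwinnertonDyer.Theorems

open Summit.BirchSwinnertonDyer.BirchSwinnertonDyer.Theses.PAdicOrderV2
open Summit.BirchSwinnertonDyer.BirchSwinnertonDyer.Theses.SelmerRank (SelmerRankLB SelmerRankUB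
  SelmerRankSmallImage SelmerRankShaPFinite)
open Literature.NumberTheory.EllipticCurves

/-! ### The two registered stubs (K2, NE2⁺ — shared verbatim with crux #3's line) -/

/-- Stub K2 (LITERATURE DEBT — Kato's Selmer-corank bound at EVERY good ordinary prime, `p = 2`
included): for `E/ℚ` (globally minimal `W`) good ordinary at the prime `p` and the newform `f` of `E`,
`corank_{ℤ_p} Sel_{p^∞}(E/ℚ) ≤ ord_{T=0} L_p(E,T)`. VERBATIM the ∀-closure of the named tree fact
`kato_selmerCorank_le_order_padicLFunction_allPrimes` (Kato, Astérisque 295, Thm. 18.4 as printed —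
no parity hypothesis; the proof is Thm. 17.4 (2) at the height-one prime `(T) ∌ p`), and verbatim
crux #3's registered stub `stub_padicBSDrank_kato`. Consumed only at `p = 2`, analytic rank `≥ 3`.
[cite: Kato2004Asterisque, Thm. 18.4 (p. 281) and Thm. 17.4 (2) (p. 273)] -/
theorem stub_katoAllPrimes :
    ∀ (W : WeierstrassCurve ℚ) [W.IsElliptic] [W.IsGloballyMinimal] (p : ℕ) [Fact p.Prime]
      {N : ℕ} [NeZero N] (f : CuspForm (CongruenceSubgroup.Gamma0 N) 2),
      Literature.NumberTheory.EllipticCurves.kato_selmerCorank_le_order_padicLFunction_allPrimes W p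
        (f := f) := by
  sorry

/-- Stub NE2⁺ (OPEN residue, beyond print: no excess zeros at `p = 2` in positive rank): for `E/ℚ`
(globally minimal `W`) good ordinary at `p = 2` (`a_2` odd), of positive Mordell–Weil rank, and the
newform `f` of `E`: `ord_{T=0} L_2(E,T) ≤ corank_{ℤ_2} Sel_{2^∞}(E/ℚ)`. VERBATIM crux #3's registered
stub `stub_padicBSDrank_noExcessTwoPos` (stmt-BirchSwinnertonDyer-0490). At odd `p` this inequality is
IMC-equality (item 15426) ∧ Conj. 1.12 at `T` (item 0509) ∧ control (landed); both items exclude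
`p = 2`, and the converse divisibility of the main conjecture is printed for odd `p` only
(Skinner–Urban 2014 §1.1). Route kill criterion (c): a failure here is class MISSTATED (repair
`p ≠ 2 →`). [cite: MazurTateTeitelbaum1986Invent, §II.10] -/
theorem stub_noExcessTwoPos :
    ∀ (W : WeierstrassCurve ℚ) [W.IsElliptic] [W.IsGloballyMinimal] (p : ℕ) [Fact p.Prime],
      p = 2 → Literature.NumberTheory.EllipticCurves.IsOrdinaryAt W p →
      ∀ {N : ℕ} [NeZero N] (f : CuspForm (CongruenceSubgroup.Gamma0 N) 2),
        Literature.NumberTheory.EllipticCurves.ModularForms.IsNewformOf W f →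
      1 ≤ W.mordellWeilRank →
      (Literature.NumberTheory.EllipticCurves.padicLFunction f
        (Literature.NumberTheory.EllipticCurves.unitRoot W p : ℚ_[p])).order ≤ W.selmerCorank p := by
  sorry

/-! ### The `p = 2` residue from K2, NE2⁺ and the Selmer side -/

/-- **`ord_{T=0} L_2(E,T) = r_an` at a good ordinary `p = 2` from the stubs K2, NE2⁺ and route
SelmerRank's items.** With `corank_{ℤ_2} Sel_{2^∞}(E/ℚ) = r_an` and `rank E(ℚ) = r_an` (landed
`selmerCorank_eq_analyticRank_of_selmerRankItems`, `mordellWeilRank_eq_analyticRank_of_selmerRankItems`):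
`r_an = 0` by interpolation (S1, `L_2(E,0) ≠ 0`); `r_an ≥ 1`: `≤` is NE2⁺ (positive rank),
`≥` is `L_2(E,0) = 0` (S1) in rank 1, parity (L2) in rank 2, K2 (`corank Sel_2 ≤ ord`) in rank `≥ 3`.
[cite: MazurTateTeitelbaum1986Invent, §II.10] -/
theorem order_eq_analyticRank_two_of_stubs (hLB : SelmerRankLB) (hUB : SelmerRankUB)
    (hSI : SelmerRankSmallImage) (hSha : SelmerRankShaPFinite) :
    ∀ (W : WeierstrassCurve ℚ) [W.IsElliptic] [W.IsGloballyMinimal] (p : ℕ) [Fact p.Prime],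
      p = 2 → Literature.NumberTheory.EllipticCurves.IsOrdinaryAt W p →
      ∀ {N : ℕ} [NeZero N] (f : CuspForm (CongruenceSubgroup.Gamma0 N) 2),
        Literature.NumberTheory.EllipticCurves.ModularForms.IsNewformOf W f →
          (Literature.NumberTheory.EllipticCurves.padicLFunction f
            (Literature.NumberTheory.EllipticCurves.unitRoot W p : ℚ_[p])).order = W.analyticRank := by
  intro W _ _ p _ hp2 hord N _ f hf
  have h1 := stub_constantCoeff_eq_zero_iff W p hord f hf
  have hsel : W.selmerCorank p = W.analyticRank :=
    selmerCorank_eq_analyticRank_of_selmerRankItems hLB hUB hSI hSha W p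
  have hrk : W.mordellWeilRank = W.analyticRank :=
    mordellWeilRank_eq_analyticRank_of_selmerRankItems hLB hUB hSI hSha W
  rcases Nat.lt_or_ge W.analyticRank 1 with h0 | hpos
  · -- analytic rank 0: the constant term is a unit of ℚ_2, so the T-order is 0
    have hr : W.analyticRank = 0 := by omega
    have hc : PowerSeries.constantCoeff (Literature.NumberTheory.EllipticCurves.padicLFunction f
        (Literature.NumberTheory.EllipticCurves.unitRoot W p : ℚ_[p])) ≠ 0 := by
      intro h
      have := h1.mp h
      omega
    rw [hr, Nat.cast_zero]
    refine PowerSeries.order_eq_nat.mpr ⟨?_, fun i hi => (Nat.not_lt_zero i hi).elim⟩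
    simpa only [PowerSeries.coeff_zero_eq_constantCoeff] using hc
  · apply le_antisymm
    · -- upper bound: NE2⁺ (positive rank) and the Selmer side
      have hrk1 : 1 ≤ W.mordellWeilRank := by omega
      have h := stub_noExcessTwoPos W p hp2 hord f hf hrk1
      rwa [hsel] at h
    · -- lower bound
      rcases Nat.lt_or_ge W.analyticRank 2 with hlt2 | h2
      · -- analytic rank 1: `L_2(E,0) = 0`, so `1 ≤ ord`
        have hr : W.analyticRank = 1 := by omega
        have hc : PowerSeries.constantCoeff (Literature.NumberTheory.EllipticCurves.padicLFunction f
            (Literature.NumberTheory.EllipticCurves.unitRoot W p : ℚ_[p])) = 0 := h1.mpr (by omega)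
        have h1le : ((1 : ℕ) : ℕ∞) ≤ (Literature.NumberTheory.EllipticCurves.padicLFunction f
            (Literature.NumberTheory.EllipticCurves.unitRoot W p : ℚ_[p])).order := by
          refine PowerSeries.nat_le_order _ 1 fun i hi => ?_
          have hi0 : i = 0 := by omega
          subst hi0
          simpa only [PowerSeries.coeff_zero_eq_constantCoeff] using hc
        rw [hr]
        exact h1le
      · rcases Nat.lt_or_ge W.analyticRank 3 with hlt3 | _
        · -- analytic rank 2: parity
          have hr : W.analyticRank = 2 := by omega
          rw [hr, Nat.cast_ofNat]
          exact stub_two_le_order_of_analyticRank_eq_two W p hord f hf hr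
        · -- analytic rank ≥ 3: K2 and the Selmer side
          have h := stub_katoAllPrimes W p f hord hf
          rwa [hsel] at h

/-! ### The odd-prime slice from six route items (no crux #5, no stub) -/

/-- **`ord_{T=0} L_p(E,T) = r_an` at every ODD good ordinary prime from six route items**
(`SelmerRankLB`, `SelmerRankUB`, `SelmerRankSmallImage`, `SelmerRankShaPFinite`, crux #4
`PAdicOrderSemisimpleR3`, crux #7 `PAdicOrderMainConjectureR7`) in EVERY analytic rank: the landed
pointwise chain `order_eq_analyticRank_of_mc_ss_control` (`ord_T L_p = ord_T g = rank X/TX = corank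
Sel = r_an`) with Mazur control discharged (`Greenberg1999_coinvariantsRank_eq_selmerCorank_rat_holds`).
Crux #5 (rank one) is not needed. [cite: GreenbergLNM1716, Thm. 1.2 and §1 p. 65] -/
theorem order_eq_analyticRank_odd_of_items (hLB : SelmerRankLB) (hUB : SelmerRankUB)
    (hSI : SelmerRankSmallImage) (hSha : SelmerRankShaPFinite) (hSS : PAdicOrderSemisimpleR3)
    (hMC : PAdicOrderMainConjectureR7) :
    ∀ (W : WeierstrassCurve ℚ) [W.IsElliptic] [W.IsGloballyMinimal] (p : ℕ) [Fact p.Prime],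
      p ≠ 2 → Literature.NumberTheory.EllipticCurves.IsOrdinaryAt W p →
      ∀ {N : ℕ} [NeZero N] (f : CuspForm (CongruenceSubgroup.Gamma0 N) 2),
        Literature.NumberTheory.EllipticCurves.ModularForms.IsNewformOf W f →
          (Literature.NumberTheory.EllipticCurves.padicLFunction f
            (Literature.NumberTheory.EllipticCurves.unitRoot W p : ℚ_[p])).order = W.analyticRank := by
  intro W _ _ p _ hp2 hord N _ f hf
  have hp3 : 3 ≤ p := by
    have := (Fact.out : p.Prime).two_le
    omega
  exact order_eq_analyticRank_of_mc_ss_control hLB hUB hSI hSha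
    Greenberg1999_coinvariantsRank_eq_selmerCorank_rat_holds W p hord f
    (fun κ γ hκ hγ hγ' D => hMC W p hp3 hord.1 hord.2 κ γ hκ hγ hγ' f hf D)
    (fun κ γ hκ hγ D x hx => hSS W p hp2 hord.1 hord.2 κ γ hκ hγ D x hx)

/-! ### Composition -/

/-- **Composition (line `Sketch`, skeleton v13).** Crux #2 `PAdicOrderComparisonR2` from the six route
items `SelmerRankLB` / `SelmerRankUB` / `SelmerRankSmallImage` / `SelmerRankShaPFinite` (whence
`corank Sel_{p^∞} = r_an` and `rank = r_an` at every `p`), crux #4 `PAdicOrderSemisimpleR3` and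
crux #7 `PAdicOrderMainConjectureR7`; the odd-prime slice `order_eq_analyticRank_odd_of_items`
(no stub) and the `p = 2` residue `order_eq_analyticRank_two_of_stubs` (stubs K2, NE2⁺; landed S1, L2).
[folklore] -/
theorem pAdicOrderComparisonR2_of_stubs (hLB : SelmerRankLB) (hUB : SelmerRankUB)
    (hSI : SelmerRankSmallImage) (hSha : SelmerRankShaPFinite) (hSS : PAdicOrderSemisimpleR3)
    (hMC : PAdicOrderMainConjectureR7) : PAdicOrderComparisonR2 := by
  intro W _ _ p _ hord N _ f hf
  by_cases hp2 : p = 2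
  · exact order_eq_analyticRank_two_of_stubs hLB hUB hSI hSha W p hp2 hord f hf
  · exact order_eq_analyticRank_odd_of_items hLB hUB hSI hSha hSS hMC W p hp2 hord f hf

/-- The same composition concluding the TWIN decl of the superseded route PAdicOrder
(`Summit.BirchSwinnertonDyer.BirchSwinnertonDyer.Theses.PAdicOrder.PAdicOrderComparisonR2`, the
other `wanted_by` entry of stmt-BirchSwinnertonDyer-0489; same statement, Iff.rfl-equal).
[folklore] -/
theorem pAdicOrderComparisonR2_of_stubs' (hLB : SelmerRankLB) (hUB : SelmerRankUB)
    (hSI : SelmerRankSmallImage) (hSha : SelmerRankShaPFinite) (hSS : PAdicOrderSemisimpleR3)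
    (hMC : PAdicOrderMainConjectureR7) :
    Summit.BirchSwinnertonDyer.BirchSwinnertonDyer.Theses.PAdicOrder.PAdicOrderComparisonR2 :=
  fun W _ _ p _ hord _ _ f hf => pAdicOrderComparisonR2_of_stubs hLB hUB hSI hSha hSS hMC W p hord f hf

/-! ### The stub-free composition: crux #2 ⇔ crux #3 modulo route SelmerRank's items -/

/-- **Crux #2 from crux #3 and route SelmerRank's items (no stub, every prime).** If
`PAdicOrderPadicBSDrankR2` (stmt-BirchSwinnertonDyer-0490: `ord_{T=0} L_p(E,T) = rank E(ℚ)` at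
every good ordinary `p`) and `SelmerRankLB` ∧ `SelmerRankUB` ∧ `SelmerRankSmallImage` ∧
`SelmerRankShaPFinite` (whence `rank E(ℚ) = r_an` for globally minimal `W`, landed
`mordellWeilRank_eq_analyticRank_of_selmerRankItems`), then `ord_{T=0} L_p(E,T) = r_an`:
crux #2 BY NAME. [folklore] -/
theorem pAdicOrderComparisonR2_of_padicBSDrank (h3 : PAdicOrderPadicBSDrankR2) (hLB : SelmerRankLB)
    (hUB : SelmerRankUB) (hSI : SelmerRankSmallImage) (hSha : SelmerRankShaPFinite) :
    PAdicOrderComparisonR2 := by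
  intro W _ _ p _ hord N _ f hf
  rw [h3 W p hord f hf, mordellWeilRank_eq_analyticRank_of_selmerRankItems hLB hUB hSI hSha W]

/-- **Conversely, crux #3 from crux #2 and route SelmerRank's items**: `ord_{T=0} L_p(E,T) = r_an =
rank E(ℚ)`. So cruxes #2 and #3 of route PAdicOrderV2 are EQUIVALENT modulo route SelmerRank's
items LB/UB/SmallImage/ShaPFinite, at every prime. [folklore] -/
theorem padicBSDrank_of_pAdicOrderComparisonR2 (h2 : PAdicOrderComparisonR2) (hLB : SelmerRankLB)
    (hUB : SelmerRankUB) (hSI : SelmerRankSmallImage) (hSha : SelmerRankShaPFinite) :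
    PAdicOrderPadicBSDrankR2 := by
  intro W _ _ p _ hord N _ f hf
  rw [h2 W p hord f hf, mordellWeilRank_eq_analyticRank_of_selmerRankItems hLB hUB hSI hSha W]

end Summit.BirchSwinnertonDyer.BirchSwinnertonDyer.Theorems
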